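import Literature.AlgebraicGeometry.HilbertScheme.LefschetzDualTransfer
import HarnessLib

/-!
# Oberdieck's Lemma 3.4 (`k = 1`) and Cor. 3.5 for transfer operators — PROVED from the Heisenberg axioms;
discharge of `Oberdieck2021_transfer_bracket` and `Oberdieck2021_transfer_lieHom`

Layer `Literature/AlgebraicGeometry/HilbertScheme`; theorem-only sequel of `HeisenbergFockSpace` /
`LefschetzDualTransfer` (no definitions, no named facts).  G. Oberdieck, *A Lie algebra action on the Chow ring of
the Hilbert scheme of points of a K3 surface*, Comment. Math. Helv. 96 (2021), §3.2 (p. 7): for a homogeneous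
correspondence `Γ` of the surface, `T_Γ = −Σ_{n>0} n^{deg Γ − 3} 𝔮ₙ𝔮₋ₙ(Γ′)` satisfies

* **Lemma 3.4** (`k = 1`, `n > 0`): `[T_Γ, 𝔮ₙ(γ)] = n^{deg Γ − 2} 𝔮ₙ(Γ(γ))` — printed proof: the term `𝔮₋ₘ(·)` of `T_Γ`
  "has to interact with" `𝔮ₙ(γ)`, `[𝔮ₘ𝔮₋ₘ(Γ′), 𝔮ₙ(γ)] = 𝔮ₘ[𝔮₋ₘ(Γ′₂), 𝔮ₙ(γ)](Γ′₁) = −n δ_{m,n} 𝔮ₙ(Γ(γ))`, and the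
  factor `−n^{deg Γ − 3} · (−n) = n^{deg Γ − 2}`;
* **Cor. 3.5**: `[T_Γ, T_Γ̃] = T_{[Γ,Γ̃]}` — both sides annihilate the vacuum and, by Lemma 3.4 and the Jacobi
  identity, have the same commutator `n^{deg Γ + deg Γ̃ − 4} 𝔮ₙ([Γ, Γ̃](γ))` with every `𝔮ₙ(γ)`, `n > 0`; an operator
  on the Fock space is determined by these data (cyclicity, `IsHeisenbergRepresentation.ext_of_commute`).

Both are proved here, following the printed argument, for EVERY Heisenberg representation `(q, vac)` of an EVEN
coefficient algebra (`A i = 0` for odd `i`, so that the super-relations LQW (2.7) are plain commutation relations —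
in the geometric files: surfaces with `H^odd(S(ℂ); ℂ) = 0`, the printed generality read in cohomology) over a field of
characteristic zero, in the rendering of `HeisenbergFockSpace` (`transferOp q C t φ = −Σ_{n≥1} n^{t−1} Σᵢ 𝔮ₙ(φεᵢ)𝔮₋ₙ(eᵢ)`,
`Γ ↔ φ` of degree `2t`, `n^{deg Γ − 3} = n^{t−1}`, `C = Σᵢ eᵢ ⊗ εᵢ` a Casimir element of the pairing `B`):
`IsHeisenbergRepresentation.transferOp_commute` and `IsHeisenbergRepresentation.transferOp_lie`; whence the
DISCHARGES `Oberdieck2021_transfer_bracket_holds`, `Oberdieck2021_transfer_lieHom_holds` of the two named facts of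
`LefschetzDualTransfer`, and Lehn's `𝔊₀(α) = T(L_α)` for surfaces with `H^odd = 0` free of the fact hypothesis
(`ChernCharacterOperators.cupOperator_zero_eq_transferOp_of_odd_vanishing'`).

## Contents (all proved; identities between operators are established at the level of vectors of `ℍ`)

* bookkeeping: `iSup_bidegPart_le_range`, `apply_ofSummand_mem_iSup/_mem_range/_eq_zero` (`𝔮ₘ : ℍₚ → ℍ_{p+m}`,
  `= 0` below the axis), `transferTerm_apply_ofSummand_eq_zero` (the `n`-th term kills `ℍₚ` for `n > p`),
  `transferOp_apply_ofSummand_of_le` (the printed sum is locally finite: any cut-off `N ≥ p` computes `T|ℍₚ`);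
* `commute_apply_of_odd_eq_zero` (even coefficients: `𝔮ₘ(a)𝔮ₗ(b) − 𝔮ₗ(b)𝔮ₘ(a) = δ_{m+l,0} m⟨a,b⟩` for ALL `a, b`);
* `transferTerm_commute_apply` (`[Σᵢ 𝔮ₙ(φεᵢ)𝔮₋ₙ(eᵢ), 𝔮ₘ(v)] = −δ_{n,m} m 𝔮ₘ(φ Σᵢ⟨eᵢ,v⟩εᵢ)`, any tensor `C`,
  `n, m > 0`);
* `transferOp_commute` (Lemma 3.4, `k = 1`), `transferOp_lie` (Cor. 3.5); the `_holds` theorems; the corollary.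

Not here: `k ≥ 2` of Lemma 3.4 (iterate `transferOp_commute`); the `n < 0` half (adjoint); the super-version for
surfaces with odd cohomology (the sign bookkeeping of LQW (2.7) — a Summits-side support statement of the Hodge ladder,
`Summit.Ventures.HodgeKum4.TransferBracketSuper`).
-/

noncomputable section

open DirectSum TensorProduct
open Literature.AlgebraicTopology.SingularHomology
open Literature.AlgebraicGeometry.Motives (SchemeOver ComplexPoints IsSmoothProjective)
open Literature.AlgebraicGeometry.Hyperkaehler (totalCohomology ofDegree totalCup totalLefschetz)
open Literature.AlgebraicGeometry.HodgeTheory (complexBetti)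

namespace Literature.AlgebraicGeometry.HilbertScheme

section Abstract

universe u v w

variable {K : Type u} [Field K]
variable {A : ℕ → Type v} [∀ i, AddCommGroup (A i)] [∀ i, Module K (A i)]
variable {Φ : ℕ → ℕ → Type w} [∀ n i, AddCommGroup (Φ n i)] [∀ n i, Module K (Φ n i)]

namespace IsHeisenbergRepresentation

variable {B : (⨁ i, A i) →ₗ[K] (⨁ i, A i) →ₗ[K] K} {q : ℤ → (⨁ i, A i) →ₗ[K] Module.End K (Fock Φ)}
  {vac : Fock Φ}

/-! #### Bi-degree bookkeeping: `𝔮ₘ(v)` maps `ℍₚ` into `ℍ_{p+m}` (`= 0` for `p + m < 0`) -/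

/-- All bigraded pieces `ℍ^{p,d}`, `d ∈ ℤ`, of first index `p ∈ ℕ` lie in the summand `ℍₚ`.
[cite: LiQinWang2002, Def. 2.5 (ii) p. 4] -/
theorem iSup_bidegPart_le_range (p : ℕ) :
    (⨆ d : ℤ, bidegPart K Φ (p : ℤ) d) ≤ LinearMap.range (Fock.ofSummand K Φ p) := by
  refine iSup_le fun d ↦ ?_
  by_cases hd : 0 ≤ d
  · obtain ⟨d', rfl⟩ := Int.eq_ofNat_of_zero_le hd
    rw [bidegPart_natCast]
    rintro _ ⟨x, rfl⟩
    exact ⟨lof K ℕ (Φ p) d' x, rfl⟩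
  · rw [bidegPart_of_neg_right _ (not_le.mp hd)]
    exact bot_le

/-- `𝔮ₘ(v)` maps the summand `ℍₚ` into `⨆_d ℍ^{p+m, d}`, for arbitrary `v` and `y ∈ ℍₚ`.
[cite: LiQinWang2002, Def. 2.9 p. 5] -/
theorem apply_ofSummand_mem_iSup (h : IsHeisenbergRepresentation B q vac) (m : ℤ) (v : ⨁ i, A i) (p : ℕ)
    (y : FockSummand Φ p) : q m v (Fock.ofSummand K Φ p y) ∈ ⨆ d : ℤ, bidegPart K Φ ((p : ℤ) + m) d := by
  induction y using DirectSum.induction_on with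
  | zero => simp only [map_zero, Submodule.zero_mem]
  | of k x =>
    rw [← DirectSum.lof_eq_of K]
    exact h.apply_of_mem_iSup m v p k x
  | add y z hy hz =>
    rw [map_add, map_add]
    exact Submodule.add_mem _ hy hz

/-- `𝔮ₘ(v)` maps `ℍₚ` into `ℍ_{p'}` when `p + m = p'`. [cite: LiQinWang2002, Def. 2.9 p. 5] -/
theorem apply_ofSummand_mem_range (h : IsHeisenbergRepresentation B q vac) (m : ℤ) (v : ⨁ i, A i) {p p' : ℕ}
    (hp : (p : ℤ) + m = p') (y : FockSummand Φ p) :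
    q m v (Fock.ofSummand K Φ p y) ∈ LinearMap.range (Fock.ofSummand K Φ p') := by
  have hmem := h.apply_ofSummand_mem_iSup m v p y
  rw [hp] at hmem
  exact iSup_bidegPart_le_range p' hmem

/-- `𝔮ₘ(v)` kills `ℍₚ` when `p + m < 0`. [cite: LiQinWang2002, Def. 2.9 p. 5] [cite: Lehn1999, §2.2 p. 8] -/
theorem apply_ofSummand_eq_zero (h : IsHeisenbergRepresentation B q vac) (m : ℤ) (v : ⨁ i, A i) {p : ℕ}
    (hp : (p : ℤ) + m < 0) (y : FockSummand Φ p) : q m v (Fock.ofSummand K Φ p y) = 0 := by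
  have hmem := h.apply_ofSummand_mem_iSup m v p y
  have hbot : (⨆ d : ℤ, bidegPart K Φ ((p : ℤ) + m) d) = ⊥ := by
    rw [iSup_eq_bot]
    exact fun d ↦ bidegPart_of_neg_left hp d
  rw [hbot, Submodule.mem_bot] at hmem
  exact hmem

/-- The `n`-th transfer term `Σᵢ 𝔮ₙ(φεᵢ)𝔮₋ₙ(eᵢ)` kills `ℍₚ` for `n > p` (it ends in the annihilation operator
`𝔮₋ₙ`). [cite: Oberdieck2021, §3.2 p. 7] -/
theorem transferTerm_apply_ofSummand_eq_zero (h : IsHeisenbergRepresentation B q vac)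
    (C : (⨁ i, A i) ⊗[K] (⨁ i, A i)) (φ : (⨁ i, A i) →ₗ[K] (⨁ i, A i)) {n : ℤ} {p : ℕ} (hn : (p : ℤ) < n)
    (y : FockSummand Φ p) : transferTerm K q C φ n (Fock.ofSummand K Φ p y) = 0 := by
  induction C using TensorProduct.induction_on with
  | zero => simp [transferTerm]
  | tmul e ε =>
    rw [transferTerm_tmul, Module.End.mul_apply, h.apply_ofSummand_eq_zero (-n) e (by omega) y, map_zero]
  | add x x' hx hx' =>
    simp only [transferTerm, map_add, LinearMap.add_apply] at hx hx' ⊢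
    rw [hx, hx', add_zero]

/-- The transfer operator on `ℍₚ` may be computed with any cut-off `N ≥ p` (the extra terms vanish).
[cite: Oberdieck2021, §3.2 p. 7] -/
theorem transferOp_apply_ofSummand_of_le (h : IsHeisenbergRepresentation B q vac)
    (C : (⨁ i, A i) ⊗[K] (⨁ i, A i)) (t : ℤ) (φ : (⨁ i, A i) →ₗ[K] (⨁ i, A i)) {p N : ℕ} (hpN : p ≤ N)
    (y : FockSummand Φ p) :
    transferOp K q C t φ (Fock.ofSummand K Φ p y) =
      -∑ n ∈ Finset.Icc 1 N, ((n : K) ^ (t - 1)) • transferTerm K q C φ (n : ℤ) (Fock.ofSummand K Φ p y) := by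
  rw [transferOp_apply_ofSummand]
  congr 1
  refine Finset.sum_subset (Finset.Icc_subset_Icc_right hpN) fun n hn hn' ↦ ?_
  have hpn : (p : ℤ) < n := by
    simp only [Finset.mem_Icc, not_and, not_le] at hn hn'
    exact_mod_cast hn' hn.1
  rw [h.transferTerm_apply_ofSummand_eq_zero C φ hpn y, smul_zero]

/-! #### The commutation relations for even coefficient algebras (at the level of vectors) -/

/-- When the odd part of the coefficient space vanishes (`A i = 0` for `i` odd — a surface with `H^odd = 0`), the
super-relations are plain commutation relations, for arbitrary (inhomogeneous) coefficients:
`𝔮ₘ(a)𝔮ₗ(b)x − 𝔮ₗ(b)𝔮ₘ(a)x = δ_{m+l,0} m⟨a,b⟩ x`. [cite: LiQinWang2002, Thm. 2.16 (i) p. 5] -/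
theorem commute_apply_of_odd_eq_zero (h : IsHeisenbergRepresentation B q vac)
    (hA : ∀ i, Odd i → ∀ a : A i, a = 0) (m l : ℤ) (a b : ⨁ i, A i) (x : Fock Φ) :
    q m a (q l b x) - q l b (q m a x) = if m + l = 0 then ((m : K) * B a b) • x else 0 := by
  induction a using DirectSum.induction_on with
  | zero =>
    simp only [map_zero, LinearMap.zero_apply, sub_self, mul_zero, zero_smul]
    split_ifs <;> rfl
  | of i a =>
    induction b using DirectSum.induction_on with
    | zero =>
      simp only [map_zero, LinearMap.zero_apply, sub_self, mul_zero, zero_smul]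
      split_ifs <;> rfl
    | of j b =>
      rw [← DirectSum.lof_eq_of K, ← DirectSum.lof_eq_of K]
      by_cases hij : Even (i * j)
      · have hb := LinearMap.congr_fun (h.bracket m l i j a b) x
        simp only [LinearMap.sub_apply, Module.End.mul_apply, hij.neg_one_pow, one_smul] at hb
        rw [hb]
        split_ifs
        · rw [LinearMap.smul_apply, Module.End.one_apply]
        · rw [LinearMap.zero_apply]
      · -- `i` and `j` are both odd, so `a = 0`
        have hi : Odd i := by
          rw [Nat.not_even_iff_odd, Nat.odd_mul] at hij
          exact hij.1
        obtain rfl : a = 0 := hA i hi a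
        simp only [map_zero, LinearMap.zero_apply, sub_self, mul_zero, zero_smul]
        split_ifs <;> rfl
    | add b b' hb hb' =>
      simp only [map_add, LinearMap.add_apply] at hb hb' ⊢
      rw [show ∀ p q r s : Fock Φ, p + q - (r + s) = (p - r) + (q - s) by intros; abel, hb, hb']
      split_ifs
      · rw [mul_add, add_smul]
      · rw [add_zero]
  | add a a' ha ha' =>
    simp only [map_add, LinearMap.add_apply] at ha ha' ⊢
    rw [show ∀ p q r s : Fock Φ, p + q - (r + s) = (p - r) + (q - s) by intros; abel, ha, ha']
    split_ifs
    · rw [mul_add, add_smul]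
    · rw [add_zero]

/-- **The commutator of a transfer term with a creation operator** (the heart of Oberdieck's Lemma 3.4): for
`n, m > 0` and `x ∈ ℍ`, `Σᵢ 𝔮ₙ(φεᵢ)𝔮₋ₙ(eᵢ)𝔮ₘ(v)x − 𝔮ₘ(v)Σᵢ 𝔮ₙ(φεᵢ)𝔮₋ₙ(eᵢ)x = −δ_{n,m} m 𝔮ₘ(φ(Σᵢ ⟨eᵢ, v⟩ εᵢ))x`,
for an arbitrary tensor `C = Σᵢ eᵢ ⊗ εᵢ` (even coefficients). [cite: Oberdieck2021, §3.2 Lemma 3.4 (proof) p. 7] -/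
theorem transferTerm_commute_apply (h : IsHeisenbergRepresentation B q vac) (hA : ∀ i, Odd i → ∀ a : A i, a = 0)
    (C : (⨁ i, A i) ⊗[K] (⨁ i, A i)) (φ : (⨁ i, A i) →ₗ[K] (⨁ i, A i)) {n m : ℤ} (hn : 0 < n) (hm : 0 < m)
    (v : ⨁ i, A i) (x : Fock Φ) :
    transferTerm K q C φ n (q m v x) - q m v (transferTerm K q C φ n x) =
      if n = m then -(((m : K)) • q m (φ (TensorProduct.lift ((LinearMap.lsmul K (⨁ i, A i)).comp (B.flip v)) C)) x)
      else 0 := by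
  induction C using TensorProduct.induction_on with
  | zero =>
    simp only [transferTerm, map_zero, LinearMap.zero_apply, sub_self, smul_zero, neg_zero]
    split_ifs <;> rfl
  | tmul e ε =>
    rw [transferTerm_tmul, TensorProduct.lift.tmul, Module.End.mul_apply, Module.End.mul_apply]
    -- `𝔮ₙ(φε)` commutes with `𝔮ₘ(v)` (`n + m ≠ 0`); `𝔮₋ₙ(e)𝔮ₘ(v) = 𝔮ₘ(v)𝔮₋ₙ(e) − δ_{n,m} n⟨e,v⟩`
    have h1 := h.commute_apply_of_odd_eq_zero hA n m (φ ε) v (q (-n) e x)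
    rw [if_neg (by omega), sub_eq_zero] at h1
    have h2 := h.commute_apply_of_odd_eq_zero hA (-n) m e v x
    rw [sub_eq_iff_eq_add'.mp h2, map_add, h1, add_sub_cancel_left]
    by_cases hnm : n = m
    · subst hnm
      rw [if_pos (by omega), if_pos rfl, LinearMap.comp_apply, LinearMap.flip_apply, LinearMap.lsmul_apply,
        map_smul, map_smul, map_smul, LinearMap.smul_apply, smul_smul, ← neg_smul]
      congr 1
      push_cast
      ring
    · rw [if_neg (by omega), if_neg hnm, map_zero]
  | add y y' hy hy' =>
    have hsplit : transferTerm K q (y + y') φ n = transferTerm K q y φ n + transferTerm K q y' φ n := by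
      simp [transferTerm, map_add]
    rw [hsplit, LinearMap.add_apply, LinearMap.add_apply, map_add,
      show ∀ p q r s : Fock Φ, p + q - (r + s) = (p - r) + (q - s) by intros; abel, hy, hy', map_add]
    split_ifs
    · rw [map_add, map_add, LinearMap.add_apply, smul_add, neg_add]
    · rw [add_zero]

/-- **Oberdieck's Lemma 3.4 (`k = 1`, `m > 0`) from the axioms**: for an even coefficient algebra over a field of
characteristic zero, a Casimir element `C` of `B`, any `φ` and `t`: `T(φ)𝔮ₘ(v) − 𝔮ₘ(v)T(φ) = mᵗ 𝔮ₘ(φv)` (`m > 0`).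
[cite: Oberdieck2021, §3.2 Lemma 3.4 p. 7] -/
theorem transferOp_commute [CharZero K] (h : IsHeisenbergRepresentation B q vac)
    (hA : ∀ i, Odd i → ∀ a : A i, a = 0) {C : (⨁ i, A i) ⊗[K] (⨁ i, A i)} (hC : IsCasimir K B C) (t : ℤ)
    (φ : (⨁ i, A i) →ₗ[K] (⨁ i, A i)) {m : ℤ} (hm : 0 < m) (v : ⨁ i, A i) :
    transferOp K q C t φ * q m v - q m v * transferOp K q C t φ = ((m : K) ^ t) • q m (φ v) := by
  obtain ⟨m', rfl⟩ := Int.eq_ofNat_of_zero_le hm.le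
  have hm' : 1 ≤ m' := by exact_mod_cast hm
  have hm0 : (m' : K) ≠ 0 := by exact_mod_cast (show m' ≠ 0 by omega)
  push_cast
  refine DirectSum.linearMap_ext K fun p ↦ LinearMap.ext fun y ↦ ?_
  simp only [LinearMap.coe_comp, Function.comp_apply, LinearMap.sub_apply, Module.End.mul_apply,
    LinearMap.smul_apply]
  rw [show (lof K ℕ (fun n ↦ FockSummand Φ n) p) y = Fock.ofSummand K Φ p y from rfl]
  -- `𝔮ₘ(v) y ∈ ℍ_{p + m}`: compute both transfer operators with the cut-off `p + m`
  obtain ⟨z, hz⟩ := h.apply_ofSummand_mem_range (m' : ℤ) v (p := p) (p' := p + m') (by push_cast; ring) y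
  rw [← hz, h.transferOp_apply_ofSummand_of_le C t φ le_rfl z,
    h.transferOp_apply_ofSummand_of_le C t φ (Nat.le_add_right p m') y, hz, map_neg, map_sum, sub_neg_eq_add,
    neg_add_eq_sub, ← Finset.sum_sub_distrib]
  have hterm : ∀ n ∈ Finset.Icc 1 (p + m'),
      q (m' : ℤ) v (((n : K) ^ (t - 1)) • transferTerm K q C φ (n : ℤ) (Fock.ofSummand K Φ p y)) -
          ((n : K) ^ (t - 1)) • transferTerm K q C φ (n : ℤ) (q (m' : ℤ) v (Fock.ofSummand K Φ p y)) =
        if n = m' then ((m' : K) ^ t) • q (m' : ℤ) (φ v) (Fock.ofSummand K Φ p y) else 0 := by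
    intro n hn
    have hn1 : (0 : ℤ) < n := by
      simp only [Finset.mem_Icc] at hn
      exact_mod_cast hn.1
    have hc := h.transferTerm_commute_apply hA C φ hn1 hm v (Fock.ofSummand K Φ p y)
    simp only [hC v, Int.cast_natCast, Nat.cast_inj] at hc
    rw [map_smul, ← smul_sub, show ∀ a b : Fock Φ, a - b = -(b - a) from fun a b ↦ (neg_sub b a).symm, hc]
    by_cases hnm : n = m'
    · subst hnm
      rw [if_pos rfl, if_pos rfl, neg_neg, smul_smul, ← zpow_add_one₀ hm0, sub_add_cancel]
    · rw [if_neg hnm, if_neg hnm, neg_zero, smul_zero]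
  rw [Finset.sum_congr rfl hterm, Finset.sum_ite_eq' (Finset.Icc 1 (p + m')) m', if_pos (by simp [hm'])]

/-- **Oberdieck's Cor. 3.5 from the axioms**: `[T(φ), T(ψ)] = T([φ, ψ])` (even coefficient algebra, Casimir `C`,
characteristic zero). [cite: Oberdieck2021, §3.2 Cor. 3.5 p. 7] -/
theorem transferOp_lie [CharZero K] (h : IsHeisenbergRepresentation B q vac)
    (hA : ∀ i, Odd i → ∀ a : A i, a = 0) {C : (⨁ i, A i) ⊗[K] (⨁ i, A i)} (hC : IsCasimir K B C) (t t' : ℤ)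
    (φ ψ : (⨁ i, A i) →ₗ[K] (⨁ i, A i)) :
    transferOp K q C t φ * transferOp K q C t' ψ - transferOp K q C t' ψ * transferOp K q C t φ =
      transferOp K q C (t + t') (φ * ψ - ψ * φ) := by
  refine h.ext_of_commute ?_ ?_
  · rw [LinearMap.sub_apply, Module.End.mul_apply, Module.End.mul_apply, transferOp_vac h C t' ψ,
      transferOp_vac h C t φ, map_zero, map_zero, sub_self, transferOp_vac h C (t + t')]
  · intro m hm v
    have hm0 : (m : K) ≠ 0 := by exact_mod_cast hm.ne'
    -- the four commutators `[T(φ), 𝔮ₘ(·)]`, `[T(ψ), 𝔮ₘ(·)]`, at the level of vectors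
    have e1 := fun x ↦ LinearMap.congr_fun (h.transferOp_commute hA hC t φ hm v) x
    have e2 := fun x ↦ LinearMap.congr_fun (h.transferOp_commute hA hC t' ψ hm v) x
    have e3 := fun x ↦ LinearMap.congr_fun (h.transferOp_commute hA hC t φ hm (ψ v)) x
    have e4 := fun x ↦ LinearMap.congr_fun (h.transferOp_commute hA hC t' ψ hm (φ v)) x
    have e5 := fun x ↦ LinearMap.congr_fun (h.transferOp_commute hA hC (t + t') (φ * ψ - ψ * φ) hm v) x
    simp only [LinearMap.sub_apply, Module.End.mul_apply, LinearMap.smul_apply] at e1 e2 e3 e4 e5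
    refine LinearMap.ext fun x ↦ ?_
    simp only [LinearMap.sub_apply, Module.End.mul_apply, map_sub]
    set Tφ := transferOp K q C t φ
    set Tψ := transferOp K q C t' ψ
    -- move `𝔮ₘ(v)` to the left through `T(ψ)` and `T(φ)`
    rw [e5 x, sub_eq_iff_eq_add'.mp (e2 x), sub_eq_iff_eq_add'.mp (e1 x), map_add, map_add, map_smul, map_smul,
      sub_eq_iff_eq_add'.mp (e1 (Tψ x)), sub_eq_iff_eq_add'.mp (e2 (Tφ x)), sub_eq_iff_eq_add'.mp (e3 x),
      sub_eq_iff_eq_add'.mp (e4 x), smul_add, smul_add, smul_smul, smul_smul, ← zpow_add₀ hm0, ← zpow_add₀ hm0,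
      add_comm t' t, LinearMap.map_sub₂, smul_sub]
    abel

end IsHeisenbergRepresentation

end Abstract

/-! ### Discharge of the two named facts, and Lehn's formula without the fact hypothesis -/

/-- **DISCHARGE of `Oberdieck2021_transfer_bracket`** (Lemma 3.4, `k = 1`, cohomological form for surfaces with
`H^odd(S(ℂ); ℂ) = 0`): an instance of `IsHeisenbergRepresentation.transferOp_commute` (the degree hypothesis on `φ`
is not needed). [cite: Oberdieck2021, §3.2 Lemma 3.4 (p. 7)] -/
theorem Oberdieck2021_transfer_bracket_holds : Oberdieck2021_transfer_bracket := by
  intro S hS hreg H 𝔑 C hC t φ _ m hm v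
  exact 𝔑.isHeisenberg.transferOp_commute hreg hC t φ hm v

/-- **DISCHARGE of `Oberdieck2021_transfer_lieHom`** (Cor. 3.5, cohomological form for surfaces with
`H^odd(S(ℂ); ℂ) = 0`): an instance of `IsHeisenbergRepresentation.transferOp_lie`.
[cite: Oberdieck2021, §3.2 Cor. 3.5 (p. 7)] -/
theorem Oberdieck2021_transfer_lieHom_holds : Oberdieck2021_transfer_lieHom := by
  intro S hS hreg H 𝔑 C hC t t' φ ψ _ _
  exact 𝔑.isHeisenberg.transferOp_lie hreg hC t t' φ ψ

/-- **Lehn's formula `𝔊₀(α) = T(L_α)` for surfaces with `H^odd = 0`, unconditionally** (the fact hypothesis of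
`cupOperator_zero_eq_transferOp_of_odd_vanishing` fed by its discharge).
[cite: Oberdieck2021, §3.1 (3.1) and §3.2 (3.5), Lemma 3.4 (pp. 6–7)] [cite: LiQinWang2002, Thm. 5.13 (iv)] -/
theorem ChernCharacterOperators.cupOperator_zero_eq_transferOp_of_odd_vanishing' {S : SchemeOver ℂ}
    {hS : IsSmoothProjective 2 S} {H : HilbertSchemesOfPoints S}
    (hreg : ∀ k : ℕ, Odd k → ∀ x : complexBetti S k, x = 0) (𝔊 : ChernCharacterOperators hS H)
    {C : totalCohomology ℂ (ComplexPoints S) ⊗[ℂ] totalCohomology ℂ (ComplexPoints S)}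
    (hC : IsCasimir ℂ (poincarePairing hS) C) (α : complexBetti S 2) :
    𝔊.cupOperator 0 (ofDegree ℂ (ComplexPoints S) 2 α) = transferOp ℂ 𝔊.q C 1 (totalLefschetz α) :=
  𝔊.cupOperator_zero_eq_transferOp_of_odd_vanishing Oberdieck2021_transfer_bracket_holds hreg hC α

end Literature.AlgebraicGeometry.HilbertScheme

end
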